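import Mathlib
import Summits.CriticalPhenomena.CardyFormulaZ2.Theorems.CardyMagicRigidityNestingRigidityStaircaseTowerProduct
import Summits.CriticalPhenomena.CardyFormulaZ2.Theorems.CardyMagicRigidityNestingRigidityStaircaseIntegrability
import Summits.CriticalPhenomena.CardyFormulaZ2.Theorems.CardyMagicRigidityNestingRigidityFirstMomentIdentity
import Summits.CriticalPhenomena.CardyFormulaZ2.Theorems.CardyMagicRigidityNestingRigiditySmearedCentringZ2
import HarnessLib

/-!
# Crux `NestingRigidity`, line `ring-cloud-tomography` (r5): the UNTILTED first-moment identity of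
# the staircase rest statistic `Θ` — pathwise tower split and EXACT centring, both lattices

Crux `Summit.CriticalPhenomena.CardyFormulaZ2.Theses.CardyMagicRigidity.NestingRigidity`
(stmt-CriticalPhenomena-4835), line `ring-cloud-tomography`, stub R2' `stub_staircaseDecoupling`,
input (QU) of `staircaseDecoupling_of_inputs` (p122218), conjunct (cmp): after
`…StaircaseTowerProduct` and `…StaircaseGoodEvent`, (cmp) is the TILTED DRIFT BOUND
`|μ* + t·meanTower E δ r| ≤ K_stair`, `μ*` the `g_tot 1_G`-tilted mean of `Θ = Σ_{u ∉ Tow} θ_u`.  This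
file proves its untilted skeleton, with no RSW content:
* §1 pathwise on both lattices: the tower loops carry the deterministic total phase
  `Σ_{u ∈ Tow} θ_u = t·N_0(r,1) + Σ_{j<n} θ_j N_0(M j, L (j+1))`, `θ_j = t + (j+1)(−t/(n+1))`
  (additive twin of `Staircase.finprod_tow_eq_pow_mul_prod`), and `Σ_u θ_u = Σ_{Tow} θ_u + Θ`;
* §2 on both lattices every piece is integrable and
  `E_δ[Θ] = E_δ[Σ_u θ_u] − t·meanTower E δ r − Σ_j θ_j E_δ[N_0(M j, L (j+1))]`;
* §3 on BOTH lattices the smeared exact centrings (`smearedCentring_zEns`, keystone K3;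
  `smearedCentring`, crux `MagicFormulaT`) at the neutral, bounded, compactly supported staircase
  density give `E_δ[Σ_u θ_u] = 0` at every mesh, hence the EXACT identity
  `E_δ[Θ] = −t·meanTower E δ r − Σ_j θ_j E_δ[N_0(M j, L (j+1))]`
  (anchor candidate `staircase_integral_restPhase_latticeEnsembles`).
What remains for the drift bound: the tilt transfer `E_tilt[Θ] − E[Θ] = O(1)` (shared with R1')
and `sup_δ E[N_0(M j, L (j+1))] < ∞`.
-/

noncomputable section

open MeasureTheory Set Filter Metric
open scoped Real Topology BigOperators

namespace Summit.CriticalPhenomena.CardyFormulaZ2.Cruxes.NestingRigidity.RingCloudTomography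

open Literature.Probability.RandomPlanarGeometry Literature.Probability.Percolation
  Literature.Probability.LatticeModels
open Summit.CriticalPhenomena.CardyFormulaZ2.Cruxes.NestingRigidity.PositiveConeWeightDoubling
  (magicWeight meanTower)

-- Local notation: the staircase cloud and its tower loops (window tower ∪ gap towers).
local notation3 "Stair(" k ", " L ", " M ", " t ", " r ")" =>
  Cloud.mk 1 k (fun _ ↦ (0 : ℂ)) (fun _ ↦ r) (fun _ ↦ t) (fun _ ↦ (0 : ℂ)) L M (fun _ ↦ -t / ((k : ℕ) : ℝ))
local notation3 "Tow(" c ", " k ", " L ", " M ", " r ")" =>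
  {u ∈ LoopConfig.loops c | (Metric.closedBall (0 : ℂ) r ⊆ {z | u.wind z ≠ 0} ∧ u.range ⊆ Metric.ball (0 : ℂ) 1) ∨
    ∃ j : Fin k, (j : ℕ) + 1 < k ∧ Metric.closedBall (0 : ℂ) ((M : Fin k → ℝ) j) ⊆ {z | u.wind z ≠ 0} ∧
      ∀ l : Fin k, j < l → u.range ⊆ Metric.ball (0 : ℂ) ((L : Fin k → ℝ) l)}

namespace Staircase

/-! ## §1 Pathwise: the tower loops carry a deterministic total phase -/

section Pathwise

variable {t r : ℝ} {n : ℕ} {L M : Fin (n + 1) → ℝ}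

/-- The window tower and the gap towers of a staircase (`1 ≤ L j < M j`, separated) are pairwise
disjoint families: a tower loop of one family cannot surround the inner ball of a later one. -/
theorem disjoint_towers (hL1 : ∀ j, 1 ≤ L j) (hLM : ∀ j, L j < M j) (hsep : ∀ j l, j < l → M j ≤ L l)
    (c : LoopConfig ℂ) :
    Disjoint {u ∈ c.loops | closedBall (0 : ℂ) r ⊆ {z | u.wind z ≠ 0} ∧ u.range ⊆ ball (0 : ℂ) 1}
      (⋃ j : Fin n, {u ∈ c.loops | closedBall (0 : ℂ) (M (Fin.castSucc j)) ⊆ {z | u.wind z ≠ 0} ∧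
        u.range ⊆ ball (0 : ℂ) (L (Fin.succ j))}) ∧
    Pairwise (Function.onFun Disjoint fun j : Fin n ↦ {u ∈ c.loops |
      closedBall (0 : ℂ) (M (Fin.castSucc j)) ⊆ {z | u.wind z ≠ 0} ∧ u.range ⊆ ball (0 : ℂ) (L (Fin.succ j))}) := by
  have hL : ∀ j, 0 < L j := fun j ↦ one_pos.trans_le (hL1 j)
  refine ⟨Set.disjoint_left.2 fun u huW huG ↦ ?_, fun i j hij ↦ Set.disjoint_left.2 fun u hui huj ↦ ?_⟩
  · obtain ⟨j, huj⟩ := Set.mem_iUnion.1 huG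
    have h1 := lt_of_closedBall_subset_of_range_subset ((hL _).trans (hLM _)).le huj.2.1 huW.2.2
    linarith [hL1 (Fin.castSucc j), hLM (Fin.castSucc j)]
  · rcases lt_or_gt_of_ne hij with h | h
    · have h1 := lt_of_closedBall_subset_of_range_subset ((hL _).trans (hLM _)).le huj.2.1 hui.2.2
      have h2 : L (Fin.succ i) ≤ L (Fin.castSucc j) :=
        inner_mono hLM hsep (Fin.castSucc_lt_iff_succ_le.1 (Fin.castSucc_lt_castSucc_iff.2 h))
      linarith [hLM (Fin.castSucc j)]
    · have h1 := lt_of_closedBall_subset_of_range_subset ((hL _).trans (hLM _)).le hui.2.1 huj.2.2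
      have h2 : L (Fin.succ j) ≤ L (Fin.castSucc i) :=
        inner_mono hLM hsep (Fin.castSucc_lt_iff_succ_le.1 (Fin.castSucc_lt_castSucc_iff.2 h))
      linarith [hLM (Fin.castSucc i)]

/-- **Pathwise additive tower split on both lattices**: the total phase of the tower loops of a
staircase with `n + 1` rings outside the unit window is DETERMINISTIC given the tower counts,
`Σ_{u ∈ Tow} θ_u = t·N_0(r,1) + Σ_{j<n} θ_j·N_0(M j, L (j+1))`, `θ_j = t + (j+1)(−t/(n+1))` (window
loops have phase `t`, gap-tower-`j` loops phase `θ_j`, `Staircase.nestingPhase_of_gapTower`). -/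
theorem finsum_tow_nestingPhase_eq : ∀ E ∈ latticeEnsembles, ∀ {δ : ℝ}, 0 < δ → ∀ (ω : E.Ω),
    0 < r → (∀ j, r ≤ L j) → (∀ j, 1 ≤ L j) → (∀ j, L j < M j) → (∀ j l, j < l → M j ≤ L l) →
    ∑ᶠ u ∈ Tow(E.X δ ω, n + 1, L, M, r), u.nestingPhase (Stair(n + 1, L, M, t, r)).density =
      t * towerCount (E.X δ ω) 0 r 1 +
        ∑ j : Fin n, (t + ((j : ℕ) + 1) * (-t / (n + 1 : ℕ))) *
          towerCount (E.X δ ω) 0 (M (Fin.castSucc j)) (L (Fin.succ j)) := by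
  intro E hE δ hδ ω hr hrL hL1 hLM hsep
  have hL : ∀ j, 0 < L j := fun j ↦ one_pos.trans_le (hL1 j)
  set c := E.X δ ω with hc
  set f := (Stair(n + 1, L, M, t, r)).density with hf
  obtain ⟨hWG, hGG⟩ := disjoint_towers (r := r) hL1 hLM hsep c
  have hWfin : {u ∈ c.loops | closedBall (0 : ℂ) r ⊆ {z | u.wind z ≠ 0} ∧ u.range ⊆ ball (0 : ℂ) 1}.Finite :=
    ConeTilt.finite_towerSet E hE hδ ω 0 r 1
  have hGfin : ∀ j : Fin n, {u ∈ c.loops | closedBall (0 : ℂ) (M (Fin.castSucc j)) ⊆ {z | u.wind z ≠ 0} ∧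
      u.range ⊆ ball (0 : ℂ) (L (Fin.succ j))}.Finite := fun j ↦ ConeTilt.finite_towerSet E hE hδ ω 0 _ _
  -- constant phases on each family
  have hθW : ∀ u ∈ {u ∈ c.loops | closedBall (0 : ℂ) r ⊆ {z | u.wind z ≠ 0} ∧ u.range ⊆ ball (0 : ℂ) 1},
      u.nestingPhase f = t := fun u hu ↦ by
    rw [nestingPhase_of_range_subset (𝔠 := Stair(n + 1, L, M, t, r)) rfl hL1 hu.2.2,
      ConeTilt.setIntegral_discDensity_eq_one 0 hr (ball_subset_closedBall.trans hu.2.1), mul_one]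
  have hθG : ∀ j : Fin n, ∀ u ∈ {u ∈ c.loops | closedBall (0 : ℂ) (M (Fin.castSucc j)) ⊆ {z | u.wind z ≠ 0} ∧
      u.range ⊆ ball (0 : ℂ) (L (Fin.succ j))},
      u.nestingPhase f = t + ((j : ℕ) + 1) * (-t / (n + 1 : ℕ)) := fun j u hu ↦ by
    rw [nestingPhase_of_gapTower (𝔠 := Stair(n + 1, L, M, t, r)) rfl hr hrL hL hLM hsep
      Fin.castSucc_lt_succ (fun i hi ↦ Fin.castSucc_lt_iff_succ_le.1 hi) hu.2.1 hu.2.2, Fin.val_castSucc]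
  rw [tow_eq_union hLM hsep c, finsum_mem_union hWG hWfin (Set.finite_iUnion hGfin),
    finsum_mem_iUnion hGG hGfin, finsum_mem_congr rfl hθW, FirstMoment.finsum_mem_const_eq,
    finsum_congr (fun j ↦ (finsum_mem_congr rfl (hθG j)).trans (FirstMoment.finsum_mem_const_eq _ _)),
    finsum_eq_sum_of_fintype]
  simp only [towerCount, hc]
  congr 1
  · ring
  · exact Finset.sum_congr rfl fun j _ ↦ by ring

/-- **Pathwise: `Σ_u θ_u = Σ_{u ∈ Tow} θ_u + Θ`** on both lattices (honest finite sums: only loops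
meeting the ball carrying the density have `θ_u ≠ 0`). -/
theorem finsum_loops_eq_tow_add_rest : ∀ E ∈ latticeEnsembles, ∀ {δ : ℝ}, 0 < δ → ∀ (ω : E.Ω),
    0 < r → (∀ j, r ≤ L j) → (∀ j, 0 < L j) → (∀ j, L j < M j) → (∀ j l, j < l → M j ≤ L l) →
    ∑ᶠ u ∈ (E.X δ ω).loops, u.nestingPhase (Stair(n + 1, L, M, t, r)).density =
      (∑ᶠ u ∈ Tow(E.X δ ω, n + 1, L, M, r), u.nestingPhase (Stair(n + 1, L, M, t, r)).density) +
        ∑ᶠ u ∈ (E.X δ ω).loops \ Tow(E.X δ ω, n + 1, L, M, r), u.nestingPhase (Stair(n + 1, L, M, t, r)).density := by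
  intro E hE δ hδ ω hr hrL hL hLM hsep
  obtain ⟨R, hR, h0⟩ := density_data (t := t) (Nat.succ_pos n) hr hrL hL hLM hsep
  have hs : ((E.X δ ω).loops ∩ Function.support fun u : UnbasedLoop ℂ ↦
      u.nestingPhase (Stair(n + 1, L, M, t, r)).density).Finite :=
    (ConeTilt.finite_loops_meeting E hE hδ ω R).subset fun u hu ↦ ⟨hu.1, by
      by_contra h
      exact hu.2 (nestingPhase_eq_zero_of_disjoint hR h0
        (Set.disjoint_iff_inter_eq_empty.2 (Set.not_nonempty_iff_eq_empty.1 h)))⟩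
  have hT : Tow(E.X δ ω, n + 1, L, M, r) ⊆ (E.X δ ω).loops := Set.sep_subset _ _
  rw [← finsum_mem_union' Set.disjoint_sdiff_right (hs.subset (Set.inter_subset_inter_left _ hT))
    (hs.subset (Set.inter_subset_inter_left _ Set.sdiff_subset)), Set.union_sdiff_cancel hT]

end Pathwise

/-! ## §2 Both lattices: integrability and `E[Θ] = E[Σ_u θ_u] − t·m − Σ_j θ_j E[N_j]` -/

section Integral

variable {t r : ℝ} {n : ℕ} {L M : Fin (n + 1) → ℝ}

/-- **The untilted mean of the staircase rest statistic on both lattices**, at every mesh `δ > 0`: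
`Σ_u θ_u` and `Θ = Σ_{u ∉ Tow} θ_u` are integrable and
`E_δ[Θ] = E_δ[Σ_u θ_u] − t·meanTower E δ r − Σ_{j<n} θ_j E_δ[N_0(M j, L (j+1))]`. -/
theorem integral_restPhase_eq : ∀ E ∈ latticeEnsembles, ∀ {δ : ℝ}, 0 < δ →
    0 < r → (∀ j, r ≤ L j) → (∀ j, 1 ≤ L j) → (∀ j, L j < M j) → (∀ j l, j < l → M j ≤ L l) →
    Integrable (fun ω ↦ ∑ᶠ u ∈ (E.X δ ω).loops, u.nestingPhase (Stair(n + 1, L, M, t, r)).density) E.P ∧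
    Integrable (fun ω ↦ ∑ᶠ u ∈ (E.X δ ω).loops \ Tow(E.X δ ω, n + 1, L, M, r),
      u.nestingPhase (Stair(n + 1, L, M, t, r)).density) E.P ∧
    ∫ ω, ∑ᶠ u ∈ (E.X δ ω).loops \ Tow(E.X δ ω, n + 1, L, M, r),
        u.nestingPhase (Stair(n + 1, L, M, t, r)).density ∂E.P =
      (∫ ω, ∑ᶠ u ∈ (E.X δ ω).loops, u.nestingPhase (Stair(n + 1, L, M, t, r)).density ∂E.P) -
        t * meanTower E δ r - ∑ j : Fin n, (t + ((j : ℕ) + 1) * (-t / (n + 1 : ℕ))) *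
          ∫ ω, (towerCount (E.X δ ω) 0 (M (Fin.castSucc j)) (L (Fin.succ j)) : ℝ) ∂E.P := by
  intro E hE δ hδ hr hrL hL1 hLM hsep
  have hL : ∀ j, 0 < L j := fun j ↦ one_pos.trans_le (hL1 j)
  obtain ⟨R, hR, h0⟩ := density_data (t := t) (Nat.succ_pos n) hr hrL hL hLM hsep
  -- integrability of the total phase: bounded measurable
  obtain ⟨B, -, hB⟩ := exists_abs_finsum_sdiff_le E hE hδ hR h0
    (fun u ↦ u.nestingPhase (Stair(n + 1, L, M, t, r)).density) (by positivity : (0 : ℝ) ≤ 2 * |t|)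
    (fun u ↦ abs_nestingPhase_le (𝔠 := Stair(n + 1, L, M, t, r)) rfl hr hL hLM u) fun _ h ↦ h
  have hAll : Integrable (fun ω ↦ ∑ᶠ u ∈ (E.X δ ω).loops, u.nestingPhase (Stair(n + 1, L, M, t, r)).density) E.P :=
    integrable_of_abs_le hE (FirstMoment.measurable_finsum_loops E hE δ _) fun ω ↦ by
      simpa only [Set.sdiff_empty] using hB ω ∅
  -- the deterministic tower part
  set D : E.Ω → ℝ := fun ω ↦ t * towerCount (E.X δ ω) 0 r 1 +
    ∑ j : Fin n, (t + ((j : ℕ) + 1) * (-t / (n + 1 : ℕ))) *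
      towerCount (E.X δ ω) 0 (M (Fin.castSucc j)) (L (Fin.succ j)) with hD
  have hDi : Integrable D E.P :=
    ((FirstMoment.integrable_towerCount E hE hδ 0 r 1).const_mul t).add
      (integrable_finsetSum' _ fun j _ ↦ (FirstMoment.integrable_towerCount E hE hδ 0 _ _).const_mul _) |>.congr
      (Eventually.of_forall fun ω ↦ by simp only [hD, Pi.add_apply, Finset.sum_apply]; rfl)
  have hsplit : ∀ ω, ∑ᶠ u ∈ (E.X δ ω).loops \ Tow(E.X δ ω, n + 1, L, M, r),
      u.nestingPhase (Stair(n + 1, L, M, t, r)).density =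
      (∑ᶠ u ∈ (E.X δ ω).loops, u.nestingPhase (Stair(n + 1, L, M, t, r)).density) - D ω := fun ω ↦ by
    rw [finsum_loops_eq_tow_add_rest E hE hδ ω hr hrL hL hLM hsep,
      finsum_tow_nestingPhase_eq E hE hδ ω hr hrL hL1 hLM hsep]
    ring
  have hRest : Integrable (fun ω ↦ ∑ᶠ u ∈ (E.X δ ω).loops \ Tow(E.X δ ω, n + 1, L, M, r),
      u.nestingPhase (Stair(n + 1, L, M, t, r)).density) E.P :=
    (hAll.sub hDi).congr (Eventually.of_forall fun ω ↦ (hsplit ω).symm)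
  refine ⟨hAll, hRest, ?_⟩
  have hDint : ∫ ω, D ω ∂E.P = t * meanTower E δ r + ∑ j : Fin n, (t + ((j : ℕ) + 1) * (-t / (n + 1 : ℕ))) *
      ∫ ω, (towerCount (E.X δ ω) 0 (M (Fin.castSucc j)) (L (Fin.succ j)) : ℝ) ∂E.P := by
    simp only [hD]
    rw [integral_add ((FirstMoment.integrable_towerCount E hE hδ 0 r 1).const_mul t)
        (integrable_finsetSum _ fun j _ ↦ (FirstMoment.integrable_towerCount E hE hδ 0 _ _).const_mul _),
      integral_const_mul, integral_finsetSum _ fun j _ ↦ (FirstMoment.integrable_towerCount E hE hδ 0 _ _).const_mul _]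
    simp only [integral_const_mul]
    rfl
  rw [integral_congr_ae (Eventually.of_forall hsplit), integral_sub hAll hDi, hDint]
  ring

end Integral

/-! ## §3 Exact centring on both lattices, hence the exact untilted identity -/

/-- **Exact centring of the staircase phases on BOTH lattices**: `E_δ[Σ_u θ_u] = 0` at every mesh
`δ > 0` — the smeared exact centrings `smearedCentring_zEns` (keystone K3, `…SmearedCentringZ2`:
point reflections + self-duality of `P_{1/2}` on `ℤ²`) and `smearedCentring` (crux `MagicFormulaT`,
line `Sketch`, on `𝕋`) at the neutral, bounded, compactly supported staircase density. -/
theorem integral_finsum_nestingPhase_eq_zero {t r : ℝ} {n : ℕ} {L M : Fin (n + 1) → ℝ} :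
    ∀ E ∈ latticeEnsembles, ∀ {δ : ℝ}, 0 < δ → 0 < r → (∀ j, r ≤ L j) → (∀ j, 0 < L j) →
    (∀ j, L j < M j) → (∀ j l, j < l → M j ≤ L l) →
    ∫ ω, (∑ᶠ u ∈ (E.X δ ω).loops, u.nestingPhase (Stair(n + 1, L, M, t, r)).density) ∂E.P = 0 := by
  intro E hE δ hδ hr hrL hL hLM hsep
  obtain ⟨R, hR, h0⟩ := density_data (t := t) (Nat.succ_pos n) hr hrL hL hLM hsep
  simp only [latticeEnsembles, Set.mem_insert_iff, Set.mem_singleton_iff] at hE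
  rcases hE with rfl | rfl
  · exact smearedCentring_zEns (Stair(n + 1, L, M, t, r)).density R _ δ
      (CloudAdmissibility.measurable_density _) (CloudAdmissibility.abs_density_le _) hR h0 hδ
  · exact Summit.CriticalPhenomena.CardyFormulaZ2.Cruxes.MagicFormulaT.LineSketch.smearedCentring half
      (Stair(n + 1, L, M, t, r)).density R _ δ (CloudAdmissibility.measurable_density _)
      (CloudAdmissibility.abs_density_le _) hR h0 hδ

end Staircase

/-- **Anchor candidate — the UNTILTED first-moment identity of the staircase rest statistic,
EXACTLY, on BOTH lattice ensembles.**  For `E ∈ latticeEnsembles`, every mesh `δ > 0` and every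
staircase with `n + 1` rings outside the unit window (`0 < r ≤ L j`, `1 ≤ L j < M j`, `M j ≤ L l`
for `j < l`), the rest statistic `Θ = Σ_{u ∉ Tow} θ_u` of (QU) has mean
`E_δ[Θ] = −t·meanTower E δ r − Σ_{j<n} θ_j·E_δ[N_0(M j, L (j+1))]`, `θ_j = t + (j+1)(−t/(n+1))`
(pathwise tower split + exact smeared centring on both lattices).  The tilted drift bound of
(QU)/(cmp) is this plus the tilt transfer `E_tilt[Θ] − E[Θ] = O(1)` and
`sup_δ E[N_0(M j, L (j+1))] < ∞`. -/
theorem staircase_integral_restPhase_latticeEnsembles : ∀ E ∈ latticeEnsembles, ∀ (δ t r : ℝ) (n : ℕ)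
    (L M : Fin (n + 1) → ℝ), 0 < δ → 0 < r → (∀ j, r ≤ L j) → (∀ j, 1 ≤ L j) → (∀ j, L j < M j) →
    (∀ j l, j < l → M j ≤ L l) →
    ∫ ω, ∑ᶠ u ∈ (E.X δ ω).loops \ {u ∈ (E.X δ ω).loops | (Metric.closedBall (0 : ℂ) r ⊆ {z | u.wind z ≠ 0} ∧
        u.range ⊆ Metric.ball (0 : ℂ) 1) ∨ ∃ j : Fin (n + 1), (j : ℕ) + 1 < n + 1 ∧
        Metric.closedBall (0 : ℂ) (M j) ⊆ {z | u.wind z ≠ 0} ∧ ∀ l : Fin (n + 1), j < l → u.range ⊆ Metric.ball (0 : ℂ) (L l)},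
      u.nestingPhase (Cloud.mk 1 (n + 1) (fun _ ↦ 0) (fun _ ↦ r) (fun _ ↦ t) (fun _ ↦ 0) L M
        (fun _ ↦ -t / (n + 1 : ℕ))).density ∂E.P =
      -t * meanTower E δ r - ∑ j : Fin n, (t + ((j : ℕ) + 1) * (-t / (n + 1 : ℕ))) *
        ∫ ω, (towerCount (E.X δ ω) 0 (M (Fin.castSucc j)) (L (Fin.succ j)) : ℝ) ∂E.P := by
  intro E hE δ t r n L M hδ hr hrL hL1 hLM hsep
  obtain ⟨-, -, h⟩ := Staircase.integral_restPhase_eq (t := t) E hE hδ hr hrL hL1 hLM hsep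
  rw [h, Staircase.integral_finsum_nestingPhase_eq_zero E hE hδ hr hrL (fun j ↦ one_pos.trans_le (hL1 j)) hLM hsep]
  ring

end Summit.CriticalPhenomena.CardyFormulaZ2.Cruxes.NestingRigidity.RingCloudTomography

end
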